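import Mathlib
import Literature.NumberTheory.LFunctions.Zhang2022.RepairBedUaSignThresholds
import HarnessLib

/-!
# Zhang (2022), rescue bed (D-0124 (3)) node D130-4 «U-a sign», MODEL side IV: the SLOT-WORD dictionary of the bed-7
# block — uv-slot / vv-slot readings of `closes_iff_of_pos` for a generic off-diagonal input, the three cell
# thresholds `r(d) = k₀·𝔅(u_T)/|c₀|²` as windows, and `λ_min` of the X = 0 model block at the closing cells

Topic `Literature/NumberTheory/LFunctions/Zhang2022` (Landau–Siegel audit tree; verdict-neutral).
Y. Zhang, *Discrete mean estimates and the Landau–Siegel zero*, arXiv:2211.02515v1 (2022) [Zhang2022LandauSiegel] —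
**an unrefereed manuscript under adjudication; nothing here asserts or denies any of its claims, and nothing here is
a claim about Landau–Siegel zeros.**

Companion of `RepairBedUaSignModel` / `RepairBedUaSignCurrencies` / `RepairBedUaSignThresholds` (atoms, closing
criterion, sign table, `θ*`, currencies, `m_K*` levels, the atom windows at the closing cells). In the tree's
coordinates (`KnifeEdgeOffDiagForm`: `q_X(s) = 𝔅(u)|s|² + 2Re(s·c) + k`, `c = crossCoeff θ X = c₀ + X(u,v)`,
`k = overhangConst θ X = k₀ + 2Re X(v,v)`) the bed-7 shape numbers are `b = k/𝔅(u_T)`, `c̃ = c/𝔅(u_T)`, and its slot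
words (spec `bed7-Ua-sign-v0.1` §2, SP6: «vv-slot-alone ⇔ b_d ≥ |c_m|²», «uv-slot-alone ⇔ b_m ≥ |c_d|²», hence
«restoration carried by the CROSS TERM / SELF TERM / SHARED / NEITHER ALONE») are statements about `q_X` for inputs
`X` living in one slot. This file records, for the taper designs `u_T ⊕ s·v` and a GENERIC pair functional `X`
(nothing about any `X` is asserted; theorems only, no definition, no `Prop` placeholder):

* Part 1 — **the dictionary**: `taper_not_closes_iff` (`¬(∃ s, q_X(s) < 0) ↔ |c|² ≤ k·𝔅(u_T)`, the bed's
  `m_data = b_d − |c_d|² ≥ 0`), the uv-slot reading `taper_uvSlot_iff` (inputs with `Re X(v,v) = 0`: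
  `¬closes ↔ |c₀ + X(u_T,v)|² ≤ k₀·𝔅(u_T)`) and the vv-slot reading `taper_vvSlot_iff` (inputs with `X(u_T,v) = 0`:
  `¬closes ↔ |c₀|² ≤ (k₀ + 2Re X(v,v))·𝔅(u_T)`);
* Part 2 — **the cell thresholds `r(d) = k₀𝔅(u_T)/|c₀|²` at the three closing cells**, in the form the words use:
  a cross-slot-only input leaving a residual `|c| ≤ ρ|c₀|` restores positivity iff `ρ² ≤ r`, a self-slot-only input
  with overhang constant `t·k₀` restores it iff `t ≥ 1/r`: **`√r ∈ (0.917, 0.918)`, `1/r ∈ (1.188, 1.189)` at `(v_J,2)`**;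
  **`√r ∈ (0.637, 0.638)`, `1/r ∈ (2.459, 2.460)` at `(v_J,3)`**; **`√r ∈ (0.791, 0.792)`, `1/r ∈ (1.597, 1.598)` at
  `(φ,3)`** (`taper_*_uvSlot_window`, `taper_*_vvSlot_window`: «residual ≤ lower end ⇒ no closing for every such X»
  ∧ «residual ≥ upper end ⇒ closing for every such X», resp. the mirror pair for `t`). Reading against bed-7's 55
  closing window cells (rows/bed7-ABC3.cells.tsv of record): the measured residual ratios `|c_d|/|c_m| ≤ 0.443`
  (medians `0.03–0.13`) sit below every `√r`; the measured self ratios `b_d/b_m ∈ [0.13, 0.77]` at the 52 cells with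
  `D ≠ −163` sit below `1 < 1/r`, and at `D = −163` read `1.008 / 1.157 / 1.767` (S1 / S2 / S3, `θ = 2`, `v_J`) against
  `1/r = 1.1887` — exactly one cell crosses the vv line, the registered SHARED cell (−163, S3); the words
  «uv-slot-alone YES», «vv-slot-alone NO ⇒ CROSS TERM» have these kernel margins; the windows say nothing about any
  genuine block by themselves;
* Part 3 — **`λ_min` of the X = 0 model block `[[𝔅(u_T), c₀],[c̄₀, k₀]]` at the closing cells**, definition-free:
  «`∃ s, q(s) < λ_U(1+|s|²)`» ∧ «`∀ s, λ_L(1+|s|²) ≤ q(s)`», `(λ_L, λ_U) = (−5.15, −5.14)` at `(v_J,2)` (there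
  `k₀ = 𝔅(u_T)`, `λ_min = 𝔅(u_T) − |c₀|`), `(−65.15, −65.14)` at `(v_J,3)`, `(−26.65, −26.64)` at `(φ,3)` (bed-7 printed
  `−5.14 / −65.1 / −26.6`).

Caveat as in the kit: `M_θ`, `θ > 1`, is formula I's calculus CONTINUED past `P`, not a proved main term; «closes /
restores positivity» are statements about that continued quadratic, not about any genuine mean value. Nothing here
evaluates a genuine block, touches a registered word, or asserts an off-diagonal input. No `instance`, no notation.
Numeric pre-validation (40 digits): bed-7 g3 session `work/p7num.py`.

## References

* Y. Zhang, arXiv:2211.02515v1 (2022), §7 Prop 7.1, (7.2) p.33; §8 (8.11)–(8.12). [cite: Zhang2022LandauSiegel, §§7, 8]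
-/

noncomputable section

open Complex Real ComplexConjugate Set intervalIntegral
open _root_.MeasureTheory

namespace Literature.NumberTheory.LFunctions.Zhang2022.Repair.Bed

open KnifeEdge

/-! ### Part 1 — the slot-word dictionary (generic input `X`) -/

section Dictionary

variable {θ : ℝ} {X : PairFunctional} {v v' : ℝ → ℂ}

/-- **No-closing criterion for the taper designs in the `X`-world** (`closes_iff_of_pos`, `𝔅(u_T) > 0`): `u_T ⊕ s·v`
does not close for any amplitude iff `|c₀ + X(u_T,v)|² ≤ (k₀ + 2Re X(v,v))·𝔅(u_T)` — the bed's «genuine block PSD»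
`m_data = b_d − |c_d|² ≥ 0` in the tree's coordinates. Nothing about `X` is asserted.
[cite: Zhang2022LandauSiegel, §7 Prop 7.1 (7.2) p.33] -/
theorem taper_not_closes_iff (θ : ℝ) (X : PairFunctional) (v v' : ℝ → ℂ) :
    (¬ ∃ s : ℂ, twoPieceMainTerm θ X taperProfile taperProfile' v v' s < 0) ↔
      ‖crossCoeff θ X taperProfile taperProfile' v v'‖ ^ 2
        ≤ overhangConst θ X v v' * mainTermForm taperProfile taperProfile' := by
  rw [closes_iff_of_pos mainTermForm_taperProfile_pos, not_lt]

/-- **uv-slot reading**: for an input living in the CROSS slot only (`Re X(v,v) = 0`, so `k = k₀`), `u_T ⊕ s·v` does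
not close iff `|c₀ + X(u_T,v)|² ≤ k₀·𝔅(u_T)` — the bed's «uv-slot-alone» test `b_m ≥ |c_d|²`.
[cite: Zhang2022LandauSiegel, §7 Prop 7.1 (7.2) p.33] -/
theorem taper_uvSlot_iff (hX : (X v v' v v').re = 0) :
    (¬ ∃ s : ℂ, twoPieceMainTerm θ X taperProfile taperProfile' v v' s < 0) ↔
      ‖tailCoupling θ taperProfile v + X taperProfile taperProfile' v v'‖ ^ 2
        ≤ (topDiagForm θ v v').re * mainTermForm taperProfile taperProfile' := by
  rw [taper_not_closes_iff, crossCoeff, overhangConst, hX, mul_zero, add_zero]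

/-- **vv-slot reading**: for an input living in the SELF slot only (`X(u_T,v) = 0`, so `c = c₀`), `u_T ⊕ s·v` does not
close iff `|c₀|² ≤ (k₀ + 2Re X(v,v))·𝔅(u_T)` — the bed's «vv-slot-alone» test `b_d ≥ |c_m|²`.
[cite: Zhang2022LandauSiegel, §7 Prop 7.1 (7.2) p.33] -/
theorem taper_vvSlot_iff (hX : X taperProfile taperProfile' v v' = 0) :
    (¬ ∃ s : ℂ, twoPieceMainTerm θ X taperProfile taperProfile' v v' s < 0) ↔
      ‖tailCoupling θ taperProfile v‖ ^ 2
        ≤ ((topDiagForm θ v v').re + 2 * (X v v' v v').re) * mainTermForm taperProfile taperProfile' := by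
  rw [taper_not_closes_iff, crossCoeff, overhangConst, hX, add_zero]

/-- uv-slot, no closing from a ratio bound: `|c| ≤ ρ|c₀|`, `ρ²|c₀|² ≤ k₀·a`. [folklore] -/
private theorem uv_not_closes (hX : (X v v' v v').re = 0) {ρ : ℝ}
    (hle : ‖crossCoeff θ X taperProfile taperProfile' v v'‖ ≤ ρ * ‖tailCoupling θ taperProfile v‖)
    (hnum : ρ ^ 2 * ‖tailCoupling θ taperProfile v‖ ^ 2
      ≤ (topDiagForm θ v v').re * mainTermForm taperProfile taperProfile') :
    ¬ ∃ s : ℂ, twoPieceMainTerm θ X taperProfile taperProfile' v v' s < 0 := by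
  rw [taper_not_closes_iff, overhangConst, hX, mul_zero, add_zero]
  calc ‖crossCoeff θ X taperProfile taperProfile' v v'‖ ^ 2
      ≤ (ρ * ‖tailCoupling θ taperProfile v‖) ^ 2 := pow_le_pow_left₀ (norm_nonneg _) hle 2
    _ = ρ ^ 2 * ‖tailCoupling θ taperProfile v‖ ^ 2 := by ring
    _ ≤ _ := hnum

/-- uv-slot, closing from a ratio bound: `ρ|c₀| ≤ |c|`, `k₀·a < ρ²|c₀|²`. [folklore] -/
private theorem uv_closes (hX : (X v v' v v').re = 0) {ρ : ℝ} (hρ : 0 ≤ ρ)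
    (hge : ρ * ‖tailCoupling θ taperProfile v‖ ≤ ‖crossCoeff θ X taperProfile taperProfile' v v'‖)
    (hnum : (topDiagForm θ v v').re * mainTermForm taperProfile taperProfile'
      < ρ ^ 2 * ‖tailCoupling θ taperProfile v‖ ^ 2) :
    ∃ s : ℂ, twoPieceMainTerm θ X taperProfile taperProfile' v v' s < 0 := by
  rw [closes_iff_of_pos mainTermForm_taperProfile_pos, overhangConst, hX, mul_zero, add_zero]
  have h0 : 0 ≤ ρ * ‖tailCoupling θ taperProfile v‖ := mul_nonneg hρ (norm_nonneg _)
  calc (topDiagForm θ v v').re * mainTermForm taperProfile taperProfile'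
      < ρ ^ 2 * ‖tailCoupling θ taperProfile v‖ ^ 2 := hnum
    _ = (ρ * ‖tailCoupling θ taperProfile v‖) ^ 2 := by ring
    _ ≤ ‖crossCoeff θ X taperProfile taperProfile' v v'‖ ^ 2 := pow_le_pow_left₀ h0 hge 2

/-- vv-slot, closing when the self constant stays below `t·k₀` with `t·k₀·a < |c₀|²`. [folklore] -/
private theorem vv_closes (hX : X taperProfile taperProfile' v v' = 0) {t : ℝ}
    (hle : overhangConst θ X v v' ≤ t * (topDiagForm θ v v').re)
    (hnum : t * (topDiagForm θ v v').re * mainTermForm taperProfile taperProfile'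
      < ‖tailCoupling θ taperProfile v‖ ^ 2) :
    ∃ s : ℂ, twoPieceMainTerm θ X taperProfile taperProfile' v v' s < 0 := by
  rw [closes_iff_of_pos mainTermForm_taperProfile_pos, crossCoeff, hX, add_zero]
  calc overhangConst θ X v v' * mainTermForm taperProfile taperProfile'
      ≤ t * (topDiagForm θ v v').re * mainTermForm taperProfile taperProfile' :=
        mul_le_mul_of_nonneg_right hle mainTermForm_taperProfile_pos.le
    _ < _ := hnum

/-- vv-slot, no closing once the self constant reaches `t·k₀` with `|c₀|² ≤ t·k₀·a`. [folklore] -/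
private theorem vv_not_closes (hX : X taperProfile taperProfile' v v' = 0) {t : ℝ}
    (hge : t * (topDiagForm θ v v').re ≤ overhangConst θ X v v')
    (hnum : ‖tailCoupling θ taperProfile v‖ ^ 2
      ≤ t * (topDiagForm θ v v').re * mainTermForm taperProfile taperProfile') :
    ¬ ∃ s : ℂ, twoPieceMainTerm θ X taperProfile taperProfile' v v' s < 0 := by
  rw [taper_not_closes_iff, crossCoeff, hX, add_zero]
  calc ‖tailCoupling θ taperProfile v‖ ^ 2
      ≤ t * (topDiagForm θ v v').re * mainTermForm taperProfile taperProfile' := hnum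
    _ ≤ _ := mul_le_mul_of_nonneg_right hge mainTermForm_taperProfile_pos.le

end Dictionary

/-! ### Part 2 — the three cell thresholds. With a pure cross-slot input of residual `|c| = ρ|c₀|` the design does
not close iff `ρ²|c₀|² ≤ k₀𝔅(u_T)`, i.e. `ρ ≤ √r`, `r = k₀𝔅(u_T)/|c₀|²`; with a pure self-slot input of overhang
constant `t·k₀` it does not close iff `|c₀|² ≤ t·k₀𝔅(u_T)`, i.e. `t ≥ 1/r`. -/

section CellThresholds

/-- **uv-slot threshold at `(v_J, 2)`: `√r ∈ (0.917, 0.918)`** (`r = 𝔅(u_T)²/(36π²(1+π²)) = 0.84129`, `k₀ = 𝔅(u_T)`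
here): every cross-slot-only input with residual `|c₀ + X(u_T,v_J)| ≤ 0.917·|c₀|` leaves `u_T ⊕ s·v_2` NOT closing, and
every such input with residual `≥ 0.918·|c₀|` makes it close (bed-7's `θ = 2` jump cells: `|c_d|/|c_m| ≤ 0.443`).
[cite: Zhang2022LandauSiegel, §7 Prop 7.1 (7.2) p.33] -/
theorem taper_jump_two_uvSlot_window :
    (∀ X : PairFunctional, (X (jumpProfile 2) (jumpProfile' 2) (jumpProfile 2) (jumpProfile' 2)).re = 0 →
      ‖crossCoeff 2 X taperProfile taperProfile' (jumpProfile 2) (jumpProfile' 2)‖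
          ≤ 0.917 * ‖tailCoupling 2 taperProfile (jumpProfile 2)‖ →
        ¬ ∃ s : ℂ, twoPieceMainTerm 2 X taperProfile taperProfile' (jumpProfile 2) (jumpProfile' 2) s < 0) ∧
    (∀ X : PairFunctional, (X (jumpProfile 2) (jumpProfile' 2) (jumpProfile 2) (jumpProfile' 2)).re = 0 →
      0.918 * ‖tailCoupling 2 taperProfile (jumpProfile 2)‖
          ≤ ‖crossCoeff 2 X taperProfile taperProfile' (jumpProfile 2) (jumpProfile' 2)‖ →
        ∃ s : ℂ, twoPieceMainTerm 2 X taperProfile taperProfile' (jumpProfile 2) (jumpProfile' 2) s < 0) := by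
  have hk := topDiagForm_jump_two_re_eq_mainTermForm
  obtain ⟨hcL, hcU⟩ := normSq_tailCoupling_jump_two_window
  obtain ⟨haL, haU⟩ := mainTermForm_taperProfile_window20
  refine ⟨fun X hX hle => uv_not_closes hX hle ?_,
    fun X hX hge => uv_closes hX (by norm_num) hge ?_⟩
  · rw [hk]
    nlinarith [mul_pos (sub_pos.2 haL) (sub_pos.2 haL)]
  · rw [hk]
    nlinarith [mul_pos (sub_pos.2 haU) (sub_pos.2 haU)]

/-- **vv-slot threshold at `(v_J, 2)`: `1/r ∈ (1.188, 1.189)`**: a self-slot-only input whose overhang constant stays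
`≤ 1.188·k₀` leaves `u_T ⊕ s·v_2` closing; one with overhang constant `≥ 1.189·k₀` restores positivity (bed-7's `θ = 2`
jump cells: `b_d/b_m ∈ [0.39, 0.77]` for `D ≠ −163` — «vv-slot-alone NO» already by the sign `Δb < 0` — and
`1.008 / 1.157 / 1.767` at `D = −163` for S1 / S2 / S3: only the S3 cell exceeds `1/r`, the registered SHARED cell).
[cite: Zhang2022LandauSiegel, §7 Prop 7.1 (7.2) p.33] -/
theorem taper_jump_two_vvSlot_window :
    (∀ X : PairFunctional, X taperProfile taperProfile' (jumpProfile 2) (jumpProfile' 2) = 0 →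
      overhangConst 2 X (jumpProfile 2) (jumpProfile' 2) ≤ 1.188 * (topDiagForm 2 (jumpProfile 2) (jumpProfile' 2)).re →
        ∃ s : ℂ, twoPieceMainTerm 2 X taperProfile taperProfile' (jumpProfile 2) (jumpProfile' 2) s < 0) ∧
    (∀ X : PairFunctional, X taperProfile taperProfile' (jumpProfile 2) (jumpProfile' 2) = 0 →
      1.189 * (topDiagForm 2 (jumpProfile 2) (jumpProfile' 2)).re ≤ overhangConst 2 X (jumpProfile 2) (jumpProfile' 2) →
        ¬ ∃ s : ℂ, twoPieceMainTerm 2 X taperProfile taperProfile' (jumpProfile 2) (jumpProfile' 2) s < 0) := by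
  have hk := topDiagForm_jump_two_re_eq_mainTermForm
  obtain ⟨hcL, hcU⟩ := normSq_tailCoupling_jump_two_window
  obtain ⟨haL, haU⟩ := mainTermForm_taperProfile_window20
  refine ⟨fun X hX hle => vv_closes hX hle ?_, fun X hX hge => vv_not_closes hX hge ?_⟩
  · rw [hk]
    nlinarith [mul_pos (sub_pos.2 haU) (sub_pos.2 haU)]
  · rw [hk]
    nlinarith [mul_pos (sub_pos.2 haL) (sub_pos.2 haL)]

/-- **uv-slot threshold at `(v_J, 3)`: `√r ∈ (0.637, 0.638)`** (`r = 0.40655`): a cross-slot-only residual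
`≤ 0.637·|c₀|` leaves `u_T ⊕ s·v_3` not closing, `≥ 0.638·|c₀|` makes it close.
[cite: Zhang2022LandauSiegel, §7 Prop 7.1 (7.2) p.33] -/
theorem taper_jump_three_uvSlot_window :
    (∀ X : PairFunctional, (X (jumpProfile 3) (jumpProfile' 3) (jumpProfile 3) (jumpProfile' 3)).re = 0 →
      ‖crossCoeff 3 X taperProfile taperProfile' (jumpProfile 3) (jumpProfile' 3)‖
          ≤ 0.637 * ‖tailCoupling 3 taperProfile (jumpProfile 3)‖ →
        ¬ ∃ s : ℂ, twoPieceMainTerm 3 X taperProfile taperProfile' (jumpProfile 3) (jumpProfile' 3) s < 0) ∧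
    (∀ X : PairFunctional, (X (jumpProfile 3) (jumpProfile' 3) (jumpProfile 3) (jumpProfile' 3)).re = 0 →
      0.638 * ‖tailCoupling 3 taperProfile (jumpProfile 3)‖
          ≤ ‖crossCoeff 3 X taperProfile taperProfile' (jumpProfile 3) (jumpProfile' 3)‖ →
        ∃ s : ℂ, twoPieceMainTerm 3 X taperProfile taperProfile' (jumpProfile 3) (jumpProfile' 3) s < 0) := by
  obtain ⟨hcL, hcU⟩ := normSq_tailCoupling_jump_three_window
  obtain ⟨haL, haU⟩ := mainTermForm_taperProfile_window20
  obtain ⟨hkL, hkU⟩ := topDiagForm_jump_three_re_window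
  refine ⟨fun X hX hle => uv_not_closes hX hle ?_,
    fun X hX hge => uv_closes hX (by norm_num) hge ?_⟩
  · nlinarith [mul_pos (sub_pos.2 hkL) (sub_pos.2 haL)]
  · nlinarith [mul_pos (sub_pos.2 hkU) (sub_pos.2 haU)]

/-- **vv-slot threshold at `(v_J, 3)`: `1/r ∈ (2.459, 2.460)`**: a self-slot-only input with overhang constant
`≤ 2.459·k₀` leaves `u_T ⊕ s·v_3` closing, `≥ 2.460·k₀` restores positivity.
[cite: Zhang2022LandauSiegel, §7 Prop 7.1 (7.2) p.33] -/
theorem taper_jump_three_vvSlot_window :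
    (∀ X : PairFunctional, X taperProfile taperProfile' (jumpProfile 3) (jumpProfile' 3) = 0 →
      overhangConst 3 X (jumpProfile 3) (jumpProfile' 3) ≤ 2.459 * (topDiagForm 3 (jumpProfile 3) (jumpProfile' 3)).re →
        ∃ s : ℂ, twoPieceMainTerm 3 X taperProfile taperProfile' (jumpProfile 3) (jumpProfile' 3) s < 0) ∧
    (∀ X : PairFunctional, X taperProfile taperProfile' (jumpProfile 3) (jumpProfile' 3) = 0 →
      2.46 * (topDiagForm 3 (jumpProfile 3) (jumpProfile' 3)).re ≤ overhangConst 3 X (jumpProfile 3) (jumpProfile' 3) →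
        ¬ ∃ s : ℂ, twoPieceMainTerm 3 X taperProfile taperProfile' (jumpProfile 3) (jumpProfile' 3) s < 0) := by
  obtain ⟨hcL, hcU⟩ := normSq_tailCoupling_jump_three_window
  obtain ⟨haL, haU⟩ := mainTermForm_taperProfile_window20
  obtain ⟨hkL, hkU⟩ := topDiagForm_jump_three_re_window
  refine ⟨fun X hX hle => vv_closes hX hle ?_, fun X hX hge => vv_not_closes hX hge ?_⟩
  · nlinarith [mul_pos (sub_pos.2 hkU) (sub_pos.2 haU)]
  · nlinarith [mul_pos (sub_pos.2 hkL) (sub_pos.2 haL)]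

/-- **uv-slot threshold at `(φ, 3)`: `√r ∈ (0.791, 0.792)`** (`r = 0.62615`): a cross-slot-only residual
`≤ 0.791·|c₀|` leaves `u_T ⊕ s·φ_3` not closing, `≥ 0.792·|c₀|` makes it close.
[cite: Zhang2022LandauSiegel, §7 Prop 7.1 (7.2) p.33] -/
theorem taper_phiT_three_uvSlot_window :
    (∀ X : PairFunctional, (X (phiT 3) (phiT' 3) (phiT 3) (phiT' 3)).re = 0 →
      ‖crossCoeff 3 X taperProfile taperProfile' (phiT 3) (phiT' 3)‖ ≤ 0.791 * ‖tailCoupling 3 taperProfile (phiT 3)‖ →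
        ¬ ∃ s : ℂ, twoPieceMainTerm 3 X taperProfile taperProfile' (phiT 3) (phiT' 3) s < 0) ∧
    (∀ X : PairFunctional, (X (phiT 3) (phiT' 3) (phiT 3) (phiT' 3)).re = 0 →
      0.792 * ‖tailCoupling 3 taperProfile (phiT 3)‖ ≤ ‖crossCoeff 3 X taperProfile taperProfile' (phiT 3) (phiT' 3)‖ →
        ∃ s : ℂ, twoPieceMainTerm 3 X taperProfile taperProfile' (phiT 3) (phiT' 3) s < 0) := by
  obtain ⟨hcL, hcU⟩ := normSq_tailCoupling_phiT_three_window
  obtain ⟨haL, haU⟩ := mainTermForm_taperProfile_window20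
  obtain ⟨hkL, hkU⟩ := topDiagForm_phiT_three_re_window
  refine ⟨fun X hX hle => uv_not_closes hX hle ?_,
    fun X hX hge => uv_closes hX (by norm_num) hge ?_⟩
  · nlinarith [mul_pos (sub_pos.2 hkL) (sub_pos.2 haL)]
  · nlinarith [mul_pos (sub_pos.2 hkU) (sub_pos.2 haU)]

/-- **vv-slot threshold at `(φ, 3)`: `1/r ∈ (1.597, 1.598)`**: a self-slot-only input with overhang constant
`≤ 1.597·k₀` leaves `u_T ⊕ s·φ_3` closing, `≥ 1.598·k₀` restores positivity.
[cite: Zhang2022LandauSiegel, §7 Prop 7.1 (7.2) p.33] -/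
theorem taper_phiT_three_vvSlot_window :
    (∀ X : PairFunctional, X taperProfile taperProfile' (phiT 3) (phiT' 3) = 0 →
      overhangConst 3 X (phiT 3) (phiT' 3) ≤ 1.597 * (topDiagForm 3 (phiT 3) (phiT' 3)).re →
        ∃ s : ℂ, twoPieceMainTerm 3 X taperProfile taperProfile' (phiT 3) (phiT' 3) s < 0) ∧
    (∀ X : PairFunctional, X taperProfile taperProfile' (phiT 3) (phiT' 3) = 0 →
      1.598 * (topDiagForm 3 (phiT 3) (phiT' 3)).re ≤ overhangConst 3 X (phiT 3) (phiT' 3) →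
        ¬ ∃ s : ℂ, twoPieceMainTerm 3 X taperProfile taperProfile' (phiT 3) (phiT' 3) s < 0) := by
  obtain ⟨hcL, hcU⟩ := normSq_tailCoupling_phiT_three_window
  obtain ⟨haL, haU⟩ := mainTermForm_taperProfile_window20
  obtain ⟨hkL, hkU⟩ := topDiagForm_phiT_three_re_window
  refine ⟨fun X hX hle => vv_closes hX hle ?_, fun X hX hge => vv_not_closes hX hge ?_⟩
  · nlinarith [mul_pos (sub_pos.2 hkU) (sub_pos.2 haU)]
  · nlinarith [mul_pos (sub_pos.2 hkL) (sub_pos.2 haL)]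

end CellThresholds

/-! ### Part 3 — `λ_min` of the X = 0 model block at the three closing cells, as definition-free windows:
`λ_min[[𝔅(u_T), c₀],[c̄₀, k₀]] = min_s q(s)/(1 + |s|²)`, so `λ_min < λ_U ⇔ ∃ s, q(s) < λ_U(1+|s|²)` and
`λ_L ≤ λ_min ⇔ ∀ s, λ_L(1+|s|²) ≤ q(s)`; shifting by `λ` gives the quadratic `(𝔅(u_T)−λ)|s|² + 2Re(s·c₀) + (k₀−λ)`. -/

section LambdaMin

/-- `Re((−t·c̄)·c) = −t|c|²`. [folklore] -/
private theorem probe_re' (t : ℝ) (c : ℂ) : ((-(t : ℂ) * conj c) * c).re = -(t * ‖c‖ ^ 2) := by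
  have : (-(t : ℂ) * conj c) * c = -((t : ℂ) * (conj c * c)) := by ring
  rw [this, Complex.conj_mul' c]
  simp [← Complex.ofReal_pow, ← Complex.ofReal_mul]

/-- `|−t·c̄|² = t²|c|²`. [folklore] -/
private theorem probe_norm_sq' (t : ℝ) (c : ℂ) : ‖-(t : ℂ) * conj c‖ ^ 2 = t ^ 2 * ‖c‖ ^ 2 := by
  rw [norm_mul, norm_neg, Complex.norm_real, Complex.norm_conj, mul_pow, Real.norm_eq_abs, sq_abs]

/-- `A > 0`, `K·A < |c|²` ⇒ `A|s|² + 2Re(s·c) + K < 0` at `s = −c̄/A` (as in `KnifeEdgeOffDiagForm` Part 0). [folklore] -/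
private theorem quad_exists_neg {A K : ℝ} {c : ℂ} (hA : 0 < A) (h : K * A < ‖c‖ ^ 2) :
    ∃ s : ℂ, A * ‖s‖ ^ 2 + 2 * (s * c).re + K < 0 := by
  refine ⟨-((1 / A : ℝ) : ℂ) * conj c, ?_⟩
  rw [probe_re', probe_norm_sq']
  have e : A * ((1 / A) ^ 2 * ‖c‖ ^ 2) + 2 * -(1 / A * ‖c‖ ^ 2) + K = (K * A - ‖c‖ ^ 2) / A := by
    field_simp
    ring
  rw [e]
  exact div_neg_of_neg_of_pos (by linarith) hA

/-- `A > 0`, `|c|² ≤ K·A` ⇒ `A|s|² + 2Re(s·c) + K ≥ 0` for every `s` (`A·q(s) = |As + c̄|² + (KA − |c|²)`). [folklore] -/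
private theorem quad_nonneg {A K : ℝ} {c : ℂ} (hA : 0 < A) (h : ‖c‖ ^ 2 ≤ K * A) (s : ℂ) :
    0 ≤ A * ‖s‖ ^ 2 + 2 * (s * c).re + K := by
  have hr : |(s * c).re| ≤ ‖s‖ * ‖c‖ := (Complex.abs_re_le_norm _).trans (norm_mul _ _).le
  have hr' := (abs_le.mp hr).1
  have hs := norm_nonneg s
  have hc := norm_nonneg c
  have key : 0 ≤ A * (A * ‖s‖ ^ 2 + 2 * (s * c).re + K) := by
    nlinarith [sq_nonneg (A * ‖s‖ - ‖c‖), mul_nonneg hA.le (by linarith : 0 ≤ ‖s‖ * ‖c‖ + (s * c).re)]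
  exact (mul_nonneg_iff_of_pos_left hA).mp key

/-- The shifted quadratic: `q(s) − λ(1+|s|²) = (𝔅(u_T)−λ)|s|² + 2Re(s·c₀) + (k₀−λ)` at `X = 0`.
[cite: Zhang2022LandauSiegel, §7 Prop 7.1 (7.2) p.33] -/
private theorem shifted (θ lam : ℝ) (v v' : ℝ → ℂ) (s : ℂ) :
    twoPieceMainTerm θ 0 taperProfile taperProfile' v v' s - lam * (1 + ‖s‖ ^ 2)
      = (mainTermForm taperProfile taperProfile' - lam) * ‖s‖ ^ 2
          + 2 * (s * tailCoupling θ taperProfile v).re + ((topDiagForm θ v v').re - lam) := by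
  rw [twoPieceMainTerm_eq, crossCoeff_zero, overhangConst_zero]
  ring

/-- `λ_min` window from the shifted quadratic: `∃`-side at `λ_U`, `∀`-side at `λ_L`. [folklore] -/
private theorem lambdaMin_window_of {θ lamL lamU : ℝ} {v v' : ℝ → ℂ}
    (hAU : 0 < mainTermForm taperProfile taperProfile' - lamU)
    (hAL : 0 < mainTermForm taperProfile taperProfile' - lamL)
    (hU : ((topDiagForm θ v v').re - lamU) * (mainTermForm taperProfile taperProfile' - lamU)
      < ‖tailCoupling θ taperProfile v‖ ^ 2)
    (hL : ‖tailCoupling θ taperProfile v‖ ^ 2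
      ≤ ((topDiagForm θ v v').re - lamL) * (mainTermForm taperProfile taperProfile' - lamL)) :
    (∃ s : ℂ, twoPieceMainTerm θ 0 taperProfile taperProfile' v v' s < lamU * (1 + ‖s‖ ^ 2)) ∧
      (∀ s : ℂ, lamL * (1 + ‖s‖ ^ 2) ≤ twoPieceMainTerm θ 0 taperProfile taperProfile' v v' s) := by
  constructor
  · obtain ⟨s, hs⟩ := quad_exists_neg hAU hU
    refine ⟨s, ?_⟩
    have e := shifted θ lamU v v' s
    linarith [e, hs]
  · intro s
    have h0 := quad_nonneg hAL hL s
    have e := shifted θ lamL v v' s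
    linarith [e, h0]

/-- **`λ_min(model) ∈ (−5.15, −5.14)` at `(v_J, 2)`** (bed-7 printed `−5.14`; `k₀ = 𝔅(u_T)` here, so
`λ_min = 𝔅(u_T) − |c₀| = 57.0008 − 62.1453`): some amplitude has `q(s) < −5.14(1+|s|²)`, and `q(s) ≥ −5.15(1+|s|²)`
for all `s`. [cite: Zhang2022LandauSiegel, §7 Prop 7.1 (7.2) p.33] -/
theorem taper_jump_two_lambdaMin_window :
    (∃ s : ℂ, twoPieceMainTerm 2 0 taperProfile taperProfile' (jumpProfile 2) (jumpProfile' 2) s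
        < -5.14 * (1 + ‖s‖ ^ 2)) ∧
      (∀ s : ℂ, -5.15 * (1 + ‖s‖ ^ 2)
        ≤ twoPieceMainTerm 2 0 taperProfile taperProfile' (jumpProfile 2) (jumpProfile' 2) s) := by
  have hk := topDiagForm_jump_two_re_eq_mainTermForm
  obtain ⟨hcL, hcU⟩ := normSq_tailCoupling_jump_two_window
  obtain ⟨haL, haU⟩ := mainTermForm_taperProfile_window20
  refine lambdaMin_window_of (by linarith) (by linarith) ?_ ?_
  · rw [hk]
    nlinarith [mul_pos (sub_pos.2 haU) (sub_pos.2 haU)]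
  · rw [hk]
    nlinarith [mul_pos (sub_pos.2 haL) (sub_pos.2 haL)]

/-- **`λ_min(model) ∈ (−65.15, −65.14)` at `(v_J, 3)`** (bed-7 printed `−65.1`).
[cite: Zhang2022LandauSiegel, §7 Prop 7.1 (7.2) p.33] -/
theorem taper_jump_three_lambdaMin_window :
    (∃ s : ℂ, twoPieceMainTerm 3 0 taperProfile taperProfile' (jumpProfile 3) (jumpProfile' 3) s
        < -65.14 * (1 + ‖s‖ ^ 2)) ∧
      (∀ s : ℂ, -65.15 * (1 + ‖s‖ ^ 2)
        ≤ twoPieceMainTerm 3 0 taperProfile taperProfile' (jumpProfile 3) (jumpProfile' 3) s) := by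
  obtain ⟨hcL, hcU⟩ := normSq_tailCoupling_jump_three_window
  obtain ⟨haL, haU⟩ := mainTermForm_taperProfile_window20
  obtain ⟨hkL, hkU⟩ := topDiagForm_jump_three_re_window
  refine lambdaMin_window_of (by linarith) (by linarith) ?_ ?_
  · nlinarith [mul_pos (sub_pos.2 hkU) (sub_pos.2 haU)]
  · nlinarith [mul_pos (sub_pos.2 hkL) (sub_pos.2 haL)]

/-- **`λ_min(model) ∈ (−26.65, −26.64)` at `(φ, 3)`** (bed-7 printed `−26.6`).
[cite: Zhang2022LandauSiegel, §7 Prop 7.1 (7.2) p.33] -/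
theorem taper_phiT_three_lambdaMin_window :
    (∃ s : ℂ, twoPieceMainTerm 3 0 taperProfile taperProfile' (phiT 3) (phiT' 3) s < -26.64 * (1 + ‖s‖ ^ 2)) ∧
      (∀ s : ℂ, -26.65 * (1 + ‖s‖ ^ 2) ≤ twoPieceMainTerm 3 0 taperProfile taperProfile' (phiT 3) (phiT' 3) s) := by
  obtain ⟨hcL, hcU⟩ := normSq_tailCoupling_phiT_three_window
  obtain ⟨haL, haU⟩ := mainTermForm_taperProfile_window20
  obtain ⟨hkL, hkU⟩ := topDiagForm_phiT_three_re_window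
  refine lambdaMin_window_of (by linarith) (by linarith) ?_ ?_
  · nlinarith [mul_pos (sub_pos.2 hkU) (sub_pos.2 haU)]
  · nlinarith [mul_pos (sub_pos.2 hkL) (sub_pos.2 haL)]

end LambdaMin

/-! ### Part 4 (rev 2, ls-rescue-bed-7 g4) — `λ_min` of the X = 0 model block at the five model-PD registered cells
`(v_J,5/4)`, `(v_J,3/2)`, `(φ,5/4)`, `(φ,3/2)`, `(φ,2)` as definition-free windows (there `λ_min > 0`: the block is PD,
`m_X0 > 0`, cf. `RepairBedUaSignShapes.shapeWindow_*`); with Part 3 the bed's `lambda_min_model` column is kernel at all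
eight registered `u_T` cells. Method: `λ_min < λ_U ⇔ (k₀−λ_U)(𝔅(u_T)−λ_U) < |c₀|²`, `λ_L ≤ λ_min ⇔ |c₀|² ≤ (k₀−λ_L)(𝔅(u_T)−λ_L)`
(`lambdaMin_window_of`), the determinants cleared of `1/π` and compared on `π`, `π²`, `π³`, `π⁴`, `π⁶` windows. -/

section LambdaMinPD

/-- Powers of `π` from the twenty-digit bounds: windows for `π²`, `π³`, `π⁴`, `π⁶`. [folklore] -/
private theorem pi_pow_bounds_pd :
    9.869604401089358 < π ^ 2 ∧ π ^ 2 < 9.869604401089359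
      ∧ 31.00627668029982 < π ^ 3 ∧ π ^ 3 < 31.00627668029983
      ∧ 97.40909103400243 < π ^ 4 ∧ π ^ 4 < 97.40909103400244
      ∧ 961.3891935753044 < π ^ 6 ∧ π ^ 6 < 961.3891935753045 := by
  have h1 := Real.pi_gt_d20
  have h2 := Real.pi_lt_d20
  have h0 : (0:ℝ) ≤ 3.14159265358979323846 := by norm_num
  have hπ : 0 ≤ π := Real.pi_pos.le
  have a2 := pow_lt_pow_left₀ h1 h0 (by norm_num : (2:ℕ) ≠ 0)
  have b2 := pow_lt_pow_left₀ h2 hπ (by norm_num : (2:ℕ) ≠ 0)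
  have a3 := pow_lt_pow_left₀ h1 h0 (by norm_num : (3:ℕ) ≠ 0)
  have b3 := pow_lt_pow_left₀ h2 hπ (by norm_num : (3:ℕ) ≠ 0)
  have a4 := pow_lt_pow_left₀ h1 h0 (by norm_num : (4:ℕ) ≠ 0)
  have b4 := pow_lt_pow_left₀ h2 hπ (by norm_num : (4:ℕ) ≠ 0)
  have a6 := pow_lt_pow_left₀ h1 h0 (by norm_num : (6:ℕ) ≠ 0)
  have b6 := pow_lt_pow_left₀ h2 hπ (by norm_num : (6:ℕ) ≠ 0)
  norm_num at a2 b2 a3 b3 a4 b4 a6 b6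
  refine ⟨?_, ?_, ?_, ?_, ?_, ?_, ?_, ?_⟩ <;> linarith

/-- The jump cell's shifted determinant cleared of `1/π`:
`(k₀ − λ)(𝔅(u_T) − λ) = (24h + 52π²h³ − 3λπ)(24 + 52π² − 3λπ)/(9π²)`. [folklore] -/
private theorem jump_det_cleared (h lam : ℝ) :
    (8 * h / π + 52 / 3 * π * h ^ 3 - lam) * (8 / π + 52 / 3 * π - lam)
      = (24 * h + 52 * π ^ 2 * h ^ 3 - 3 * lam * π) * (24 + 52 * π ^ 2 - 3 * lam * π) / (9 * π ^ 2) := by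
  have hπ : π ≠ 0 := Real.pi_ne_zero
  field_simp
  ring

/-- The arch cell's shifted determinant cleared of `1/π`:
`(k₀ − λ)(𝔅(u_T) − λ) = (40h³ + 44π²h⁵ − 15λπ)(120 + 260π² − 15λπ)/(225π²)`. [folklore] -/
private theorem phiT_det_cleared (h lam : ℝ) :
    (8 * h ^ 3 / (3 * π) + 44 / 15 * π * h ^ 5 - lam) * (8 / π + 52 / 3 * π - lam)
      = (40 * h ^ 3 + 44 * π ^ 2 * h ^ 5 - 15 * lam * π) * (120 + 260 * π ^ 2 - 15 * lam * π)
          / (225 * π ^ 2) := by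
  have hπ : π ≠ 0 := Real.pi_ne_zero
  field_simp
  ring

/-- **`λ_min(model) ∈ (1.217, 1.218)` at `(v_J, 5/4)`** (bed-7's model table printed `1.2170`; PD cell).
[cite: Zhang2022LandauSiegel, §7 Prop 7.1 (7.2) p.33] -/
theorem taper_jump_five_quarters_lambdaMin_window :
    (∃ s : ℂ, twoPieceMainTerm (5/4) 0 taperProfile taperProfile' (jumpProfile (5/4)) (jumpProfile' (5/4)) s
        < 1.218 * (1 + ‖s‖ ^ 2)) ∧
      (∀ s : ℂ, 1.217 * (1 + ‖s‖ ^ 2)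
        ≤ twoPieceMainTerm (5/4) 0 taperProfile taperProfile' (jumpProfile (5/4)) (jumpProfile' (5/4)) s) := by
  obtain ⟨haL, haU⟩ := mainTermForm_taperProfile_window20
  have h1 := Real.pi_gt_d20
  have h2 := Real.pi_lt_d20
  obtain ⟨h2l, h2u, h3l, h3u, h4l, h4u, h6l, h6u⟩ := pi_pow_bounds_pd
  have hθ : (1:ℝ) ≤ 5/4 := by norm_num
  refine lambdaMin_window_of (by linarith) (by linarith) ?_ ?_ <;>
    rw [topDiagForm_jumpProfile_re hθ, mainTermForm_taperProfile, norm_sq_tailCoupling_taper_jumpProfile hθ,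
      jump_det_cleared]
  · rw [div_lt_iff₀ (by positivity)]
    nlinarith [h1, h2, h2l, h2u, h3l, h3u, h4l, h4u, h6l, h6u]
  · rw [le_div_iff₀ (by positivity)]
    nlinarith [h1, h2, h2l, h2u, h3l, h3u, h4l, h4u, h6l, h6u]

/-- **`λ_min(model) ∈ (3.563, 3.564)` at `(v_J, 3/2)`** (model table `3.5630`; PD cell).
[cite: Zhang2022LandauSiegel, §7 Prop 7.1 (7.2) p.33] -/
theorem taper_jump_three_halves_lambdaMin_window :
    (∃ s : ℂ, twoPieceMainTerm (3/2) 0 taperProfile taperProfile' (jumpProfile (3/2)) (jumpProfile' (3/2)) s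
        < 3.564 * (1 + ‖s‖ ^ 2)) ∧
      (∀ s : ℂ, 3.563 * (1 + ‖s‖ ^ 2)
        ≤ twoPieceMainTerm (3/2) 0 taperProfile taperProfile' (jumpProfile (3/2)) (jumpProfile' (3/2)) s) := by
  obtain ⟨haL, haU⟩ := mainTermForm_taperProfile_window20
  have h1 := Real.pi_gt_d20
  have h2 := Real.pi_lt_d20
  obtain ⟨h2l, h2u, h3l, h3u, h4l, h4u, h6l, h6u⟩ := pi_pow_bounds_pd
  have hθ : (1:ℝ) ≤ 3/2 := by norm_num
  refine lambdaMin_window_of (by linarith) (by linarith) ?_ ?_ <;>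
    rw [topDiagForm_jumpProfile_re hθ, mainTermForm_taperProfile, norm_sq_tailCoupling_taper_jumpProfile hθ,
      jump_det_cleared]
  · rw [div_lt_iff₀ (by positivity)]
    nlinarith [h1, h2, h2l, h2u, h3l, h3u, h4l, h4u, h6l, h6u]
  · rw [le_div_iff₀ (by positivity)]
    nlinarith [h1, h2, h2l, h2u, h3l, h3u, h4l, h4u, h6l, h6u]

/-- **`λ_min(model) ∈ (0.02042, 0.02043)` at `(φ, 5/4)`** (model table `0.020424`; PD cell).
[cite: Zhang2022LandauSiegel, §7 Prop 7.1 (7.2) p.33] -/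
theorem taper_phiT_five_quarters_lambdaMin_window :
    (∃ s : ℂ, twoPieceMainTerm (5/4) 0 taperProfile taperProfile' (phiT (5/4)) (phiT' (5/4)) s
        < 0.02043 * (1 + ‖s‖ ^ 2)) ∧
      (∀ s : ℂ, 0.02042 * (1 + ‖s‖ ^ 2)
        ≤ twoPieceMainTerm (5/4) 0 taperProfile taperProfile' (phiT (5/4)) (phiT' (5/4)) s) := by
  obtain ⟨haL, haU⟩ := mainTermForm_taperProfile_window20
  have h1 := Real.pi_gt_d20
  have h2 := Real.pi_lt_d20
  obtain ⟨h2l, h2u, h3l, h3u, h4l, h4u, h6l, h6u⟩ := pi_pow_bounds_pd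
  have hθ : (1:ℝ) ≤ 5/4 := by norm_num
  refine lambdaMin_window_of (by linarith) (by linarith) ?_ ?_ <;>
    rw [topDiagForm_phiT_re hθ, mainTermForm_taperProfile, norm_sq_tailCoupling_taper_phiT hθ, phiT_det_cleared]
  · rw [div_lt_iff₀ (by positivity)]
    nlinarith [h1, h2, h2l, h2u, h3l, h3u, h4l, h4u, h6l, h6u]
  · rw [le_div_iff₀ (by positivity)]
    nlinarith [h1, h2, h2l, h2u, h3l, h3u, h4l, h4u, h6l, h6u]

/-- **`λ_min(model) ∈ (0.2758, 0.2759)` at `(φ, 3/2)`** (model table `0.27588`; PD cell).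
[cite: Zhang2022LandauSiegel, §7 Prop 7.1 (7.2) p.33] -/
theorem taper_phiT_three_halves_lambdaMin_window :
    (∃ s : ℂ, twoPieceMainTerm (3/2) 0 taperProfile taperProfile' (phiT (3/2)) (phiT' (3/2)) s
        < 0.2759 * (1 + ‖s‖ ^ 2)) ∧
      (∀ s : ℂ, 0.2758 * (1 + ‖s‖ ^ 2)
        ≤ twoPieceMainTerm (3/2) 0 taperProfile taperProfile' (phiT (3/2)) (phiT' (3/2)) s) := by
  obtain ⟨haL, haU⟩ := mainTermForm_taperProfile_window20
  have h1 := Real.pi_gt_d20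
  have h2 := Real.pi_lt_d20
  obtain ⟨h2l, h2u, h3l, h3u, h4l, h4u, h6l, h6u⟩ := pi_pow_bounds_pd
  have hθ : (1:ℝ) ≤ 3/2 := by norm_num
  refine lambdaMin_window_of (by linarith) (by linarith) ?_ ?_ <;>
    rw [topDiagForm_phiT_re hθ, mainTermForm_taperProfile, norm_sq_tailCoupling_taper_phiT hθ, phiT_det_cleared]
  · rw [div_lt_iff₀ (by positivity)]
    nlinarith [h1, h2, h2l, h2u, h3l, h3u, h4l, h4u, h6l, h6u]
  · rw [le_div_iff₀ (by positivity)]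
    nlinarith [h1, h2, h2l, h2u, h3l, h3u, h4l, h4u, h6l, h6u]

/-- **`λ_min(model) ∈ (2.229, 2.230)` at `(φ, 2)`** (model table `2.2295`; PD cell — the arch does not close at
`θ = 2`, `taper_phiT_not_closes_two`). [cite: Zhang2022LandauSiegel, §7 Prop 7.1 (7.2) p.33] -/
theorem taper_phiT_two_lambdaMin_window :
    (∃ s : ℂ, twoPieceMainTerm 2 0 taperProfile taperProfile' (phiT 2) (phiT' 2) s < 2.230 * (1 + ‖s‖ ^ 2)) ∧
      (∀ s : ℂ, 2.229 * (1 + ‖s‖ ^ 2) ≤ twoPieceMainTerm 2 0 taperProfile taperProfile' (phiT 2) (phiT' 2) s) := by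
  obtain ⟨haL, haU⟩ := mainTermForm_taperProfile_window20
  have h1 := Real.pi_gt_d20
  have h2 := Real.pi_lt_d20
  obtain ⟨h2l, h2u, h3l, h3u, h4l, h4u, h6l, h6u⟩ := pi_pow_bounds_pd
  have hθ : (1:ℝ) ≤ 2 := by norm_num
  refine lambdaMin_window_of (by linarith) (by linarith) ?_ ?_ <;>
    rw [topDiagForm_phiT_re hθ, mainTermForm_taperProfile, norm_sq_tailCoupling_taper_phiT hθ, phiT_det_cleared]
  · rw [div_lt_iff₀ (by positivity)]
    nlinarith [h1, h2, h2l, h2u, h3l, h3u, h4l, h4u, h6l, h6u]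
  · rw [le_div_iff₀ (by positivity)]
    nlinarith [h1, h2, h2l, h2u, h3l, h3u, h4l, h4u, h6l, h6u]

end LambdaMinPD

end Literature.NumberTheory.LFunctions.Zhang2022.Repair.Bed
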